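import Literature.NumberTheory.ComplexMultiplication.WeilNumberTorus
import Literature.NumberTheory.ComplexMultiplication.SerreGroupCharacterValues
import HarnessLib

/-!
# Milne 1999 §5 «THE MAP `P → S`»: the Weil numbers `g(a) = ∏_τ τ(a)^{g(τ)}` attached to a character `g` of the
# Serre group `S^K` and an integer `a ∈ K` of norm `p^k`, `g(a)·ιg(a) = Nm_{K/ℚ}(a)^{−wt(g)}`, and the homomorphism
# `g ↦ [g(a)] : X^*(S^K) → W(p^∞) = X^*(P)` commuting with `Γ` — i.e. `α^K : (P, p) → (S^K, s^K)` on characters and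
# on points (J. S. Milne, *Lefschetz motives and the Tate conjecture*, Compositio Math. 117 (1999), §5 pp. 62–63)

Family `hodge`, lane `lit-hodgefound` (Layer A3; seat `lit-hodgefound-p27`, generation 15, row g15-#4); topic
`Literature/NumberTheory/ComplexMultiplication`, namespace `Literature.NumberTheory.ComplexMultiplication.CMNumbers`.  THIRD FILE
of the seat's Milne-1999 series (g15-#2 `WeilNumberGroups`: `IsWeilNumber`, `W(pⁿ) = weilGroup`; g15-#3 `WeilNumberTorus`:
`W(p^∞) = WeilLimit`, `[π] = weilGerm`, `X^*(P) = weilLimRep`, `P(R) = weilTorusPoints`, `[p] = pGerm`, `germChar`), joined to skel-3's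
character module of the Serre group (`SerreGroupCharacters`: `infinityTypes G E ι = X^*(S^K)`, `weight`, `characterRep`) in the
`ℚ^{cm}`-model of Q768 FILE 3 `SerreGroupTorusPoints` (`E = Hom_ℚ(K, ℚ^{cm})`, `G = Γ = Gal(ℚ^{cm}/ℚ)`, `ι = cmNumbersConj`;
`infinityTypesRep`, `constChar` (= `s^K`), `serrePoints ℚ ℚ^{cm} K ι R = S^K(R)`).  Small carriers with bodies (`serreCharEval`,
`embEquivComplex`, `PPowNormElt`, `alphaUnit`/`alphaChar`/`alphaPoints`, `toComplexChar`) + THEOREMS; no named fact (D-0026, net debt 0).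
Also used BY NAME: the tree's `SerreGroupCharacterValues` (`charEval`, `unitCharEval_pow_eq_one` — Milne CM Rem. 4.15) and
`Pohlmann1968.isPretransitive_ringEquiv_complex` (transitivity of `Aut(ℂ)` on `Hom(K, ℂ)`).

THE PRINT.  [Milne1999] §5 p. 62 L28 – p. 63 L14 (held `paper:doi-10-1023-a-1000776613765` p0018–p0019), verbatim: «THE MAP
`P → S`.  We review the construction of the map `P → S` that is conjecturally associated with the reduction of motives of
CM-type.  Fix a CM-field `K ⊂ ℚ^{al}` of finite degree and Galois over `ℚ` and a prime `w₀` of `K` lying over `p`. Recall that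
`X^*(S^K)` consists of the homomorphisms `g : Hom(K, ℚ^{al}) → ℤ` such that `g + ιg` is constant, and that the weight of `g` is
`−g − ιg`.  For `g ∈ X^*(S^K)` and `a ∈ K`, define `g(a) = ∏_{τ : K → ℚ^{al}} (τa)^{g(τ)} ∈ ℚ^{al}`. Then
`g(a)·ιg(a) = Nm_{K/ℚ} a^{−wt(g)}`. If `a` lies in the real subfield `F` of `K`, then `g(a) = Nm_{F/ℚ}(a)^{−wt(g)}`. Because the
group of units of `F` has finite index in the group of units of `K`, this shows that `g` maps units in `K` to roots of unity.
Let `ϖ` generate the ideal `𝔭_{w₀}^h`, where `h` is the order of the prime ideal `𝔭_{w₀}` corresponding to `w₀` in the class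
group of `K`. According to the above remarks, `g(ϖ)` is independent of the choice of `ϖ` up to a root of unity, and it is a
Weil `p^{f(𝔭_{w₀}/p)h}`-number of weight `wt(g)`. … The class it represents in `W^K(p^∞)` is independent of the choice of `ϖ`,
and so we have a homomorphism `g ↦ [g(ϖ)] : X^*(S^K) → W^K(p^∞)`.  We sometimes denote this map as `g ↦ π(g)`. It commutes
with the action of `Γ`, and so defines a homomorphism `α^K : P^K → S^K`.»; p. 63 Remark 5.2 (c): «The homomorphism
`α^K : P^K → S^K` sends `p^K` to `s^K`.»

DICTIONARY.  As in the seat's files, `ℚ^{al}` is replaced by `ℚ^{cm} = cmNumbers` (every embedding of a CM or totally real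
field lands in `ℚ^{cm}` — the tree's `NumberFields.fieldRange_le_cmNumbers_iff`; §2's `embEquivComplex`), `Γ = Gal(ℚ^{cm}/ℚ) =
(cmNumbers ≃ₐ[ℚ] cmNumbers)` acting on `E = (K →ₐ[ℚ] cmNumbers)` by composition (the tree's scoped `algEquivCompAction`),
`ι = cmNumbersConj`; `X^*(S^K) = infinityTypes Γ E ι` (skel-3), `wt(g) = weight ι τ₀ g = −(g(τ₀) + g(ιτ₀))` (independent of
`τ₀`); `g(a) = serreCharEval g a ∈ (ℚ^{cm})ˣ` for `a ∈ Kˣ`.  The hypothesis «`ϖ` generates `𝔭_{w₀}^h`» enters §3–§5 ONLY through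
its consequence `ϖ ∈ 𝓞_K`, `Nm_{K/ℚ}(ϖ) = p^k` with `k = f(𝔭_{w₀}/p)·h ≥ 1` (`Nm 𝔭_{w₀}^h = p^{fh}`), recorded as the structure
`PPowNormElt K p` (an algebraic integer of `K` with norm a positive power of `p`); for such `a`, `g(a) ∈ W(p^k)` with
`weilExp = −wt(g)` (g15-#2's sign: `π·ιπ = (p^k)^{weilExp}`), and `[g(a)] ∈ W(p^∞)` (g15-#3) — Milne's finer target `W^K(p^∞) ⊂ W(p^∞)`
(p. 61: the `π ∈ K` with `f_π(w) ∈ ℤ`) and the quotient `P^K` of `P` are not separated here: `α^K` is built as `P → S^K`.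

WHAT IS HERE (all PROVED):
* §1 DEF **`serreCharEval g : Kˣ →* (ℚ^{cm})ˣ`, `a ↦ g(a) = ∏_τ τ(a)^{g(τ)}`** («define `g(a) = ∏_{τ:K→ℚ^{al}} (τa)^{g(τ)}`»), for ANY
  number field `K` and any `g : Hom_ℚ(K, ℚ^{cm}) → ℤ`; `coe_serreCharEval_apply`, `serreCharEval_add/_zero/_neg/_zsmul` (a
  homomorphism in `g`), **`map_serreCharEval : σ(g(a)) = (σg)(a)`** for `σ ∈ Γ` («It commutes with the action of `Γ`»; `σg =
  characterRep σ g = g ∘ σ⁻¹`), `cmNumbersConj_serreCharEval` (`ι g(a) = (ιg)(a)`), `serreCharEval_const` (`𝟙(a) = ∏_τ τ a`).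
* §2 (for `K` totally real or CM) DEF `embEquivComplex : Hom_ℚ(K, ℚ^{cm}) ≃ Hom_ℚ(K, ℂ)`, **`prod_apply_eq_algebraMap_norm`**
  (`∏_τ τ(a) = Nm_{K/ℚ}(a)`), and **`serreCharEval_mul_conj : g(a)·ιg(a) = Nm_{K/ℚ}(a)^{−wt(g)}`** for `g ∈ X^*(S^K)` — THE PRINTED
  IDENTITY (the real-subfield formula `g(a) = Nm_{F/ℚ}(a)^{−wt(g)}` and «`g` maps units to roots of unity» are the tree's
  `coe_charEval_map_algebraMap` / `unitCharEval_pow_eq_one` of `SerreGroupCharacterValues`, Milne CM Rem. 4.15, on the complex carrier).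
* §3 **`isWeilNumber_serreCharEval`**: for `g ∈ X^*(S^K)`, `a ∈ 𝓞_K` with `Nm_{K/ℚ}(a) = p^k`: **`g(a)` IS A WEIL `p^k`-NUMBER OF WEIGHT
  `wt(g)`** (`IsWeilNumber p k (−wt g) (g(a))`: (a) from §2, (b) `p^{k·Σ|g(τ)|}·g(a)` is an algebraic integer, via
  `isIntegral_norm_div` — `Nm(a)/a ∈ 𝓞_K`); DEF `PPowNormElt K p` (the data `a ∈ 𝓞_K`, `Nm a = p^k`, `k ≥ 1`), `PPowNormElt.ofNat`
  (`a = p`, `k = [K:ℚ]`).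
* §4 DEF **`alphaUnit ϖ g ∈ W(p^k)`** (`= g(ϖ)`), DEF **`alphaChar ϖ : X^*(S^K) →ₗ[ℤ] X^*(P) = Additive W(p^∞)`, `g ↦ [g(ϖ)]`** («we have a
  homomorphism `g ↦ [g(ϖ)] : X^*(S^K) → W(p^∞)`»), `toMul_alphaChar_apply`, **`alphaChar_infinityTypesRep`** («It commutes with the
  action of `Γ`»: `[σg(ϖ)] = σ[g(ϖ)]`), **`weilLimExp_alphaChar`** (`[g(ϖ)]` has weight `wt(g)`), **`alphaChar_constChar : s^K ↦ [p]`**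
  (`𝟙(ϖ) = Nm ϖ = p^k`, `[p^k]_k = [p]` — Remark 5.2 (c) on characters), `alphaChar_mem_weilLimOnePlus`-type facts are NOT claimed.
* §6 (for `K` CM) DEF `toComplexChar` (the character read on `Hom(K, ℂ)`), **`coe_coe_serreCharEval`** (`g(a)` in `ℂ` is the tree's
  `charEval`), **`toComplexChar_mem`** (it lies in skel-3's `charGroup K`), **`serreCharEval_unit_pow_eq_one`** («`g` maps units in `K` to
  roots of unity» — the tree's `unitCharEval_pow_eq_one`, Milne CM Rem. 4.15, transported), and **`alphaChar_eq_of_elt_eq_mul_unit`** («The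
  class it represents in `W(p^∞)` is independent of the choice of `ϖ`»: `ϖ′ = ϖu`, `u ∈ 𝓞_K^×` ⟹ `[g(ϖ′)] = [g(ϖ)]` for all `g`).
* §5 DEF **`alphaPoints ϖ R : P(R) →* S^K(R)`** for every commutative `ℚ`-algebra `R` («defines a homomorphism `α^K : P^K → S^K`»; Q768
  FILE 1's `torusPoints.comap` of `alphaChar`), `alphaPoints_apply_ofAdd` (`α(f)(g) = f([g(ϖ)])`), `map_alphaPoints` (natural in `R`),
  **`eval_constChar_alphaPoints : s^K(α(f)) = p(f)`** («`α^K` sends `p^K` to `s^K`», Remark 5.2 (c), on points).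

NOT here: the choice of `ϖ` itself (a generator of `𝔭_{w₀}^h`, `h` the order of `[𝔭_{w₀}]`, `Nm ϖ = p^{fh}`), (5.1)
`f_{g(ϖ)}(w) = Σ_{τw₀ = w} g(τ)` and `g(ϖ) ∈ W^K`, Lemma 5.1 and Remark 5.2 (a)(b) (injectivity of `α^K`, `α : P → S` at the limit),
`W^K(pⁿ)`/`P^K` (§4 p. 61), the real-subfield formula (the tree's `coe_charEval_map_algebraMap`, not re-read here) — later rows; the
reduction functor and Theorem 5.4 (Shimura–Taniyama ⟹ reduction realises `α`) — Layer B.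

## References

* [Milne1999] J. S. Milne, *Lefschetz motives and the Tate conjecture*, Compositio Math. 117 (1999) 45–76 — §5 «The reduction functor on
  Lefschetz motives of CM-type», «The map P → S» p. 62 L28 – p. 63 L9, Remark 5.2 (c) p. 63 (held `paper:doi-10-1023-a-1000776613765`
  p0018–p0019); §4 p. 61 (`W^K`).
* [MilneCM2006] J. S. Milne, *Complex Multiplication* (course notes), Ch. I §4 Rem. 4.15 (`f(a) = ∏ φ(a)^{f(φ)}`; the tree's
  `SerreGroupCharacterValues.lean`), §1 Rem. 1.7 (`ρK ⊂ ℚ^{cm}` iff `K` is CM or totally real; the tree's `CMNumbers.lean`).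
* [MilneShih1982Taniyama] J. S. Milne, K.-y. Shih, LNM 900 (1982) art. III §1 (1.1) (`X^*(S^K)`; skel-3's `SerreGroupCharacters.lean`).
* [Milne2017] J. S. Milne, *Algebraic Groups*, CUP (2017), Ch. 12 Thm. 12.9 (points of groups of multiplicative type; Q768 FILE 1).

Provenance: lane `lit-hodgefound`, seat `lit-hodgefound-p27` gen 15 (agent `literature-prover-lit-hodgefound-p27-g15-0`),
row g15-#4 (INBOX 2026-08-23T01:19:45Z l.5676).
-/

set_option autoImplicit false

noncomputable section

open scoped TensorProduct

namespace Literature.NumberTheory.ComplexMultiplication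

namespace CMNumbers

open _root_.NumberField
open Literature.NumberTheory.NumberFields (cmNumbers cmNumbersConj cmNumbersConj_mul_self cmNumbersConj_mul_comm
  fieldRange_le_cmNumbers_iff)
open Literature.RingTheory.GaloisAlgebras.CharacterModuleTorus (torusPoints galUnits)
open SerreGroupTorus (infinityTypesRep coe_infinityTypesRep_apply constChar coe_constChar serrePoints)

variable {K : Type} [Field K] [NumberField K]

/-! ### §1 `g(a) = ∏_τ τ(a)^{g(τ)}` and its `Γ`-equivariance -/

/-- **`g(a) = ∏_{τ : K → ℚ^{cm}} τ(a)^{g(τ)} ∈ (ℚ^{cm})ˣ`** for `g : Hom_ℚ(K, ℚ^{cm}) → ℤ` and `a ∈ Kˣ` («For `g ∈ X^*(S^K)` and `a ∈ K`,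
define `g(a) = ∏_{τ:K→ℚ^{al}} (τa)^{g(τ)}`»), as a homomorphism in `a`. [cite: Milne1999, §5 p. 62 L33–L34] -/
def serreCharEval (g : (K →ₐ[ℚ] cmNumbers) → ℤ) : Kˣ →* cmNumbersˣ where
  toFun a := ∏ τ : K →ₐ[ℚ] cmNumbers, Units.map (τ : K →* cmNumbers) a ^ g τ
  map_one' := by simp
  map_mul' a b := by
    simp only [map_mul, mul_zpow, Finset.prod_mul_distrib]

/-- Unfolding `g(a)` in `(ℚ^{cm})ˣ`. [cite: Milne1999, §5 p. 62 L33–L34] -/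
theorem serreCharEval_apply (g : (K →ₐ[ℚ] cmNumbers) → ℤ) (a : Kˣ) :
    serreCharEval g a = ∏ τ : K →ₐ[ℚ] cmNumbers, Units.map (τ : K →* cmNumbers) a ^ g τ := rfl

/-- **`g(a) = ∏_τ τ(a)^{g(τ)}` in `ℚ^{cm}`.** [cite: Milne1999, §5 p. 62 L33–L34] -/
theorem coe_serreCharEval_apply (g : (K →ₐ[ℚ] cmNumbers) → ℤ) (a : Kˣ) :
    ((serreCharEval g a : cmNumbersˣ) : cmNumbers) = ∏ τ : K →ₐ[ℚ] cmNumbers, τ (a : K) ^ g τ := by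
  rw [serreCharEval_apply, Units.coe_prod]
  refine Finset.prod_congr rfl fun τ _ => ?_
  rw [Units.val_zpow_eq_zpow_val, Units.coe_map, MonoidHom.coe_coe]

/-- `(g + g′)(a) = g(a)·g′(a)` (the map `g ↦ g(a)` is a homomorphism). [cite: Milne1999, §5 p. 63 L7–L8] -/
theorem serreCharEval_add (g g' : (K →ₐ[ℚ] cmNumbers) → ℤ) : serreCharEval (g + g') = serreCharEval g * serreCharEval g' := by
  ext a : 1
  simp only [MonoidHom.mul_apply, serreCharEval_apply, Pi.add_apply, zpow_add, Finset.prod_mul_distrib]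

/-- `0(a) = 1`. [cite: Milne1999, §5 p. 63 L7–L8] -/
theorem serreCharEval_zero : serreCharEval (0 : (K →ₐ[ℚ] cmNumbers) → ℤ) = 1 := by
  ext a : 1
  simp [serreCharEval_apply]

/-- `(n g)(a) = g(a)^n`. [cite: Milne1999, §5 p. 63 L7–L8] -/
theorem serreCharEval_zsmul (n : ℤ) (g : (K →ₐ[ℚ] cmNumbers) → ℤ) : serreCharEval (n • g) = serreCharEval g ^ n := by
  ext a : 1
  simp only [MonoidHom.zpow_apply, serreCharEval_apply, Pi.smul_apply, smul_eq_mul]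
  rw [← Finset.prod_zpow]
  refine Finset.prod_congr rfl fun τ _ => ?_
  rw [mul_comm, zpow_mul]

/-- `(−g)(a) = g(a)⁻¹`. [cite: Milne1999, §5 p. 63 L7–L8] -/
theorem serreCharEval_neg (g : (K →ₐ[ℚ] cmNumbers) → ℤ) : serreCharEval (-g) = (serreCharEval g)⁻¹ := by
  ext a : 1
  simp only [MonoidHom.inv_apply, serreCharEval_apply, Pi.neg_apply, zpow_neg, Finset.prod_inv_distrib]

/-- `𝟙(a) = ∏_τ τ(a)` for the constant character `1` (the character `s^K`). [cite: Milne1999, §5 p. 62 L33–L34, p. 63 Rem. 5.2 (c)] -/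
theorem coe_serreCharEval_const_one (a : Kˣ) :
    ((serreCharEval (fun _ : K →ₐ[ℚ] cmNumbers => (1 : ℤ)) a : cmNumbersˣ) : cmNumbers) = ∏ τ : K →ₐ[ℚ] cmNumbers, τ (a : K) := by
  rw [coe_serreCharEval_apply]
  simp only [zpow_one]

/-- **«It commutes with the action of `Γ`»: `σ(g(a)) = (σg)(a)`** for `σ ∈ Γ = Gal(ℚ^{cm}/ℚ)`, where `(σg)(τ) = g(σ⁻¹τ)` is skel-3's
`characterRep` (reindex the product by `τ ↦ στ`). [cite: Milne1999, §5 p. 63 L8–L9] -/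
theorem map_serreCharEval (σ : cmNumbers ≃ₐ[ℚ] cmNumbers) (g : (K →ₐ[ℚ] cmNumbers) → ℤ) (a : Kˣ) :
    σ ((serreCharEval g a : cmNumbersˣ) : cmNumbers) =
      ((serreCharEval (characterRep (cmNumbers ≃ₐ[ℚ] cmNumbers) (K →ₐ[ℚ] cmNumbers) σ g) a : cmNumbersˣ) : cmNumbers) := by
  rw [coe_serreCharEval_apply, coe_serreCharEval_apply, map_prod]
  simp_rw [map_zpow₀, characterRep_apply]
  exact Fintype.prod_equiv (MulAction.toPerm σ) _ _ fun τ => by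
    rw [MulAction.toPerm_apply, inv_smul_smul, algEquiv_smul_apply]

/-- On units: `σ · g(a) = (σg)(a)` in `(ℚ^{cm})ˣ`. [cite: Milne1999, §5 p. 63 L8–L9] -/
theorem units_map_serreCharEval (σ : cmNumbers ≃ₐ[ℚ] cmNumbers) (g : (K →ₐ[ℚ] cmNumbers) → ℤ) (a : Kˣ) :
    Units.map (σ : cmNumbers →* cmNumbers) (serreCharEval g a) =
      serreCharEval (characterRep (cmNumbers ≃ₐ[ℚ] cmNumbers) (K →ₐ[ℚ] cmNumbers) σ g) a :=
  Units.ext (by rw [Units.coe_map, MonoidHom.coe_coe]; exact map_serreCharEval σ g a)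

/-- `ι g(a) = (ιg)(a)` with `(ιg)(τ) = g(ιτ)` (`ι⁻¹ = ι`). [cite: Milne1999, §5 p. 62 L34 («g(a)·ιg(a)»)] -/
theorem cmNumbersConj_serreCharEval (g : (K →ₐ[ℚ] cmNumbers) → ℤ) (a : Kˣ) :
    cmNumbersConj ((serreCharEval g a : cmNumbersˣ) : cmNumbers) =
      ∏ τ : K →ₐ[ℚ] cmNumbers, τ (a : K) ^ g (cmNumbersConj • τ) := by
  rw [map_serreCharEval, coe_serreCharEval_apply]
  refine Finset.prod_congr rfl fun τ _ => ?_
  rw [characterRep_apply, inv_eq_of_mul_eq_one_right cmNumbersConj_mul_self]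

/-! ### §2 `g(a)·ιg(a) = Nm_{K/ℚ}(a)^{−wt(g)}` (for `K` totally real or CM, so that `Hom(K, ℚ^{al}) = Hom(K, ℚ^{cm})`) -/

variable (K) in
/-- For `K` totally real or CM, every complex embedding of `K` lands in `ℚ^{cm}` (Milne CM Rem. 1.7, the tree's
`fieldRange_le_cmNumbers_iff`): **`Hom_ℚ(K, ℚ^{cm}) ≃ Hom_ℚ(K, ℂ)`**. [cite: MilneCM2006, Ch. I §1 Rem. 1.7 (p. 11)] -/
def embEquivComplex (hK : IsTotallyReal K ∨ IsCMField K) : (K →ₐ[ℚ] cmNumbers) ≃ (K →ₐ[ℚ] ℂ) where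
  toFun τ := (IntermediateField.val cmNumbers).comp τ
  invFun φ :=
    { toFun := fun x => ⟨φ x, (fieldRange_le_cmNumbers_iff K φ.toRingHom).mpr hK ⟨x, rfl⟩⟩
      map_one' := Subtype.ext (map_one φ)
      map_mul' := fun x y => Subtype.ext (map_mul φ x y)
      map_zero' := Subtype.ext (map_zero φ)
      map_add' := fun x y => Subtype.ext (map_add φ x y)
      commutes' := fun q => Subtype.ext (φ.commutes q) }
  left_inv τ := by ext x; rfl
  right_inv φ := by ext x; rfl

/-- `embEquivComplex τ = τ` followed by `ℚ^{cm} ⊂ ℂ`. [cite: MilneCM2006, Ch. I §1 Rem. 1.7 (p. 11)] -/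
@[simp] theorem embEquivComplex_apply (hK : IsTotallyReal K ∨ IsCMField K) (τ : K →ₐ[ℚ] cmNumbers) (x : K) :
    embEquivComplex K hK τ x = ((τ x : cmNumbers) : ℂ) := rfl

/-- `Hom_ℚ(K, ℚ^{cm})` is non-empty for `K` totally real or CM. [cite: MilneCM2006, Ch. I §1 Rem. 1.7 (p. 11)] -/
theorem nonempty_algHom_cmNumbers (hK : IsTotallyReal K ∨ IsCMField K) : Nonempty (K →ₐ[ℚ] cmNumbers) :=
  let ⟨φ⟩ := (inferInstance : Nonempty (K →+* ℂ))
  ⟨(embEquivComplex K hK).symm φ.toRatAlgHom⟩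

/-- **`∏_{τ : K → ℚ^{cm}} τ(a) = Nm_{K/ℚ}(a)`** for `K` totally real or CM (Mathlib's `Algebra.norm_eq_prod_embeddings` over `ℂ`,
transported along `embEquivComplex`). [cite: Milne1999, §5 p. 62 L34 («g(a)·ιg(a) = Nm_{K/ℚ} a^{−wt(g)}»)] -/
theorem prod_apply_eq_algebraMap_norm (hK : IsTotallyReal K ∨ IsCMField K) (a : K) :
    ∏ τ : K →ₐ[ℚ] cmNumbers, τ a = algebraMap ℚ cmNumbers (Algebra.norm ℚ a) := by
  apply (IntermediateField.val cmNumbers).toRingHom.injective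
  change (IntermediateField.val cmNumbers) (∏ τ : K →ₐ[ℚ] cmNumbers, τ a) =
    (IntermediateField.val cmNumbers) (algebraMap ℚ cmNumbers (Algebra.norm ℚ a))
  have h2 : (IntermediateField.val cmNumbers) (algebraMap ℚ cmNumbers (Algebra.norm ℚ a)) =
      algebraMap ℚ ℂ (Algebra.norm ℚ a) := by
    rw [eq_ratCast, eq_ratCast]; rfl
  rw [map_prod, h2, Algebra.norm_eq_prod_embeddings ℚ ℂ a]
  exact Fintype.prod_equiv (embEquivComplex K hK) _ _ fun τ => rfl

/-- **`g(a)·ιg(a) = Nm_{K/ℚ}(a)^{−wt(g)}`** for `g ∈ X^*(S^K)` (`g(τ) + g(ιτ) = −wt(g)` for every `τ`, skel-3's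
`apply_add_apply_smul_eq_neg_weight`; `K` totally real or CM). [cite: Milne1999, §5 p. 62 L34] -/
theorem serreCharEval_mul_conj (hK : IsTotallyReal K ∨ IsCMField K) {g : (K →ₐ[ℚ] cmNumbers) → ℤ}
    (hg : g ∈ infinityTypes (cmNumbers ≃ₐ[ℚ] cmNumbers) (K →ₐ[ℚ] cmNumbers) cmNumbersConj) (τ₀ : K →ₐ[ℚ] cmNumbers) (a : Kˣ) :
    ((serreCharEval g a : cmNumbersˣ) : cmNumbers) * cmNumbersConj ((serreCharEval g a : cmNumbersˣ) : cmNumbers) =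
      algebraMap ℚ cmNumbers (Algebra.norm ℚ (a : K)) ^ (-weight cmNumbersConj τ₀ g) := by
  rw [cmNumbersConj_serreCharEval, coe_serreCharEval_apply, ← Finset.prod_mul_distrib]
  have hne : ∀ τ : K →ₐ[ℚ] cmNumbers, τ (a : K) ≠ 0 := fun τ => (map_ne_zero τ).mpr a.ne_zero
  rw [Finset.prod_congr rfl fun τ _ => (zpow_add₀ (hne τ) _ _).symm]
  simp_rw [apply_add_apply_smul_eq_neg_weight cmNumbersConj_mul_self hg τ₀]
  rw [Finset.prod_zpow, prod_apply_eq_algebraMap_norm hK]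

/-! ### §3 `g(a)` is a Weil `p^k`-number of weight `wt(g)` when `a ∈ 𝓞_K` has norm `p^k` -/

/-- `Nm_{K/ℚ}(a)/a ∈ 𝓞_K` for `a ∈ 𝓞_K`, `a ≠ 0` (it is the product of the other conjugates of `a`). [cite: Milne1999, §5 p. 63 L3–L5 («it is a Weil … -number», condition (b))] -/
theorem isIntegral_norm_div {a : K} (ha : IsIntegral ℤ a) (ha0 : a ≠ 0) :
    IsIntegral ℤ (algebraMap ℚ K (Algebra.norm ℚ a) * a⁻¹) := by
  classical
  obtain ⟨φ₀⟩ := (inferInstance : Nonempty (K →+* ℂ))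
  let ψ : K →ₐ[ℚ] ℂ := φ₀.toRatAlgHom
  refine (isIntegral_algHom_iff ψ.toRingHom.toIntAlgHom ψ.toRingHom.injective).mp ?_
  change IsIntegral ℤ (ψ (algebraMap ℚ K (Algebra.norm ℚ a) * a⁻¹))
  have hprod : ψ (algebraMap ℚ K (Algebra.norm ℚ a) * a⁻¹) = ∏ φ ∈ (Finset.univ.erase ψ), φ a := by
    rw [map_mul, AlgHom.commutes, Algebra.norm_eq_prod_embeddings ℚ ℂ a, map_inv₀,
      ← Finset.mul_prod_erase Finset.univ (fun φ : K →ₐ[ℚ] ℂ => φ a) (Finset.mem_univ ψ), mul_comm,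
      ← mul_assoc, inv_mul_cancel₀ ((map_ne_zero ψ).mpr ha0), one_mul]
  rw [hprod]
  exact IsIntegral.prod _ fun φ _ => map_isIntegral_int φ ha

/-- `(p^k)^{|e|} · u^e` is integral when `u` and `p^k u⁻¹` are (both signs of `e`). [cite: Milne1999, §5 p. 63 L3–L5] -/
private theorem isIntegral_pow_natAbs_mul_zpow {c u : cmNumbers} (hc : IsIntegral ℤ c) (hu : IsIntegral ℤ u)
    (hcu : IsIntegral ℤ (c * u⁻¹)) (e : ℤ) : IsIntegral ℤ (c ^ e.natAbs * u ^ e) := by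
  cases e with
  | ofNat n =>
    rw [Int.ofNat_eq_natCast, Int.natAbs_natCast, zpow_natCast, ← mul_pow]
    exact (hc.mul hu).pow n
  | negSucc n =>
    rw [Int.natAbs_negSucc, zpow_negSucc, ← inv_pow, ← mul_pow]
    exact hcu.pow _

/-- `Nm_{K/ℚ}(a) = p^k` forces `a ≠ 0`. [cite: Milne1999, §5 p. 63 L3–L5] -/
theorem ne_zero_of_norm_eq_pow {p : ℕ} [hp : Fact p.Prime] {a : K} {k : ℕ} (hN : Algebra.norm ℚ a = (p : ℚ) ^ k) : a ≠ 0 := by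
  rintro rfl
  rw [Algebra.norm_zero] at hN
  exact pow_ne_zero k (Nat.cast_ne_zero.mpr hp.out.ne_zero) hN.symm

/-- **`g(a)` IS A WEIL `p^k`-NUMBER OF WEIGHT `wt(g)`** for `g ∈ X^*(S^K)` and `a ∈ 𝓞_K` with `Nm_{K/ℚ}(a) = p^k` («`g(ϖ)` … is a Weil
`p^{f(𝔭_{w₀}/p)h}`-number of weight `wt(g)`»; for `ϖ` generating `𝔭_{w₀}^h`, `Nm ϖ = p^{fh}`): (a) `g(a)·ιg(a) = (p^k)^{−wt(g)}` by §2 —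
the single equation suffices in `ℚ^{cm}` (g15-#2 `isWeilNumber_iff`); (b) `p^{kΣ|g(τ)|}·g(a) = ∏_τ (p^k)^{|g(τ)|} τ(a)^{g(τ)}` is an
algebraic integer since `τ(a)` and `p^k/τ(a) = τ(Nm(a)/a)` are.  In g15-#2's convention the exponent is `weilExp = −wt(g)`.
[cite: Milne1999, §5 p. 63 L3–L5] -/
theorem isWeilNumber_serreCharEval {p : ℕ} [hp : Fact p.Prime] (hK : IsTotallyReal K ∨ IsCMField K)
    {g : (K →ₐ[ℚ] cmNumbers) → ℤ} (hg : g ∈ infinityTypes (cmNumbers ≃ₐ[ℚ] cmNumbers) (K →ₐ[ℚ] cmNumbers) cmNumbersConj)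
    (τ₀ : K →ₐ[ℚ] cmNumbers) {a : K} (ha : IsIntegral ℤ a) {k : ℕ} (hN : Algebra.norm ℚ a = (p : ℚ) ^ k) :
    IsWeilNumber p k (-weight cmNumbersConj τ₀ g)
      ((serreCharEval g (Units.mk0 a (ne_zero_of_norm_eq_pow hN)) : cmNumbersˣ) : cmNumbers) := by
  classical
  rw [isWeilNumber_iff]
  refine ⟨?_, k * ∑ τ : K →ₐ[ℚ] cmNumbers, (g τ).natAbs, ?_⟩
  · rw [serreCharEval_mul_conj hK hg τ₀, Units.val_mk0, hN, map_pow, map_natCast]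
  · have ha0 : a ≠ 0 := ne_zero_of_norm_eq_pow hN
    have hc : IsIntegral ℤ ((p : cmNumbers) ^ k) := by
      rw [← map_natCast (algebraMap ℤ cmNumbers) p]
      exact isIntegral_algebraMap.pow k
    have hb : IsIntegral ℤ ((p : K) ^ k * a⁻¹) := by
      have h := isIntegral_norm_div ha ha0
      rwa [hN, map_pow, map_natCast] at h
    rw [coe_serreCharEval_apply, Units.val_mk0, pow_mul, ← Finset.prod_pow_eq_pow_sum, ← Finset.prod_mul_distrib]
    refine IsIntegral.prod _ fun τ _ => isIntegral_pow_natAbs_mul_zpow hc (map_isIntegral_int τ ha) ?_ (g τ)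
    have h := map_isIntegral_int τ hb
    rwa [map_mul, map_inv₀, map_pow, map_natCast] at h

variable (K) in
/-- **The datum replacing «`ϖ` generates `𝔭_{w₀}^h`»**: an algebraic integer `a` of `K` whose norm is a positive power `p^k` of `p`
(for such `ϖ`, `k = f(𝔭_{w₀}/p)·h`). [cite: Milne1999, §5 p. 63 L1–L5] -/
structure PPowNormElt (p : ℕ) : Type where
  /-- the element `a ∈ 𝓞_K` -/
  elt : K
  /-- the exponent `k ≥ 1` with `Nm_{K/ℚ}(a) = p^k` -/
  level : ℕ+
  isIntegral_elt : IsIntegral ℤ elt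
  norm_elt : Algebra.norm ℚ elt = (p : ℚ) ^ (level : ℕ)

namespace PPowNormElt

variable {p : ℕ} [hp : Fact p.Prime]

/-- `a ≠ 0`. [cite: Milne1999, §5 p. 63 L1–L5] -/
theorem elt_ne_zero (ϖ : PPowNormElt K p) : ϖ.elt ≠ 0 := ne_zero_of_norm_eq_pow ϖ.norm_elt

/-- `a` as a unit of `K`. [cite: Milne1999, §5 p. 63 L1–L5] -/
def unit (ϖ : PPowNormElt K p) : Kˣ := Units.mk0 ϖ.elt ϖ.elt_ne_zero

/-- [cite: Milne1999, §5 p. 63 L1–L5] -/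
@[simp] theorem coe_unit (ϖ : PPowNormElt K p) : (ϖ.unit : K) = ϖ.elt := rfl

omit hp in
variable (K p) in
/-- EXAMPLE: `a = p ∈ ℤ ⊂ 𝓞_K`, of norm `p^{[K:ℚ]}`. [cite: Milne1999, §4 p. 62 L14 («The element p ∈ K is a Weil p-number of weight −2»)] -/
def ofNat : PPowNormElt K p where
  elt := p
  level := ⟨Module.finrank ℚ K, Module.finrank_pos⟩
  isIntegral_elt := by rw [← map_natCast (algebraMap ℤ K) p]; exact isIntegral_algebraMap
  norm_elt := by
    rw [show (p : K) = algebraMap ℚ K (p : ℚ) from (map_natCast _ p).symm, Algebra.norm_algebraMap, PNat.mk_coe]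

omit hp in
/-- [cite: Milne1999, §4 p. 62 L14] -/
@[simp] theorem ofNat_elt : (ofNat K p).elt = p := rfl

end PPowNormElt

/-! ### §4 The homomorphism `g ↦ [g(ϖ)] : X^*(S^K) → W(p^∞) = X^*(P)` -/

section Alpha

variable {p : ℕ} [hp : Fact p.Prime] (hK : IsTotallyReal K ∨ IsCMField K) (ϖ : PPowNormElt K p)
include hK

/-- **`g(ϖ) ∈ W(p^k)`** as an element of g15-#2's `weilGroup p k`, for `g ∈ X^*(S^K)`. [cite: Milne1999, §5 p. 63 L3–L6] -/
def alphaUnit (g : infinityTypes (cmNumbers ≃ₐ[ℚ] cmNumbers) (K →ₐ[ℚ] cmNumbers) cmNumbersConj) : weilGroup p ϖ.level :=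
  ⟨serreCharEval (g : (K →ₐ[ℚ] cmNumbers) → ℤ) ϖ.unit,
    ⟨_, isWeilNumber_serreCharEval hK g.2 (Classical.choice (nonempty_algHom_cmNumbers hK)) ϖ.isIntegral_elt ϖ.norm_elt⟩⟩

/-- `alphaUnit ϖ g = g(ϖ)` in `(ℚ^{cm})ˣ`. [cite: Milne1999, §5 p. 63 L3–L6] -/
@[simp] theorem coe_alphaUnit (g : infinityTypes (cmNumbers ≃ₐ[ℚ] cmNumbers) (K →ₐ[ℚ] cmNumbers) cmNumbersConj) :
    ((alphaUnit hK ϖ g : weilGroup p ϖ.level) : cmNumbersˣ) = serreCharEval (g : (K →ₐ[ℚ] cmNumbers) → ℤ) ϖ.unit := rfl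

/-- `(g + g′)(ϖ) = g(ϖ) g′(ϖ)` in `W(p^k)`. [cite: Milne1999, §5 p. 63 L7–L8] -/
theorem alphaUnit_add (g g' : infinityTypes (cmNumbers ≃ₐ[ℚ] cmNumbers) (K →ₐ[ℚ] cmNumbers) cmNumbersConj) :
    alphaUnit hK ϖ (g + g') = alphaUnit hK ϖ g * alphaUnit hK ϖ g' :=
  Subtype.ext (by rw [coe_alphaUnit, Submodule.coe_add, serreCharEval_add, MonoidHom.mul_apply]; rfl)

/-- `0(ϖ) = 1`. [cite: Milne1999, §5 p. 63 L7–L8] -/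
theorem alphaUnit_zero : alphaUnit hK ϖ 0 = 1 :=
  Subtype.ext (by rw [coe_alphaUnit, Submodule.coe_zero, serreCharEval_zero, MonoidHom.one_apply]; rfl)

/-- The weight of `g(ϖ) ∈ W(p^k)`: `weilExp = −wt(g) = g(τ₀) + g(ιτ₀)`. [cite: Milne1999, §5 p. 63 L3–L5 («of weight wt(g)»)] -/
theorem weilExp_alphaUnit (g : infinityTypes (cmNumbers ≃ₐ[ℚ] cmNumbers) (K →ₐ[ℚ] cmNumbers) cmNumbersConj)
    (τ₀ : K →ₐ[ℚ] cmNumbers) : weilExp (alphaUnit hK ϖ g) = -weight cmNumbersConj τ₀ (g : (K →ₐ[ℚ] cmNumbers) → ℤ) :=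
  weilExp_eq (isWeilNumber_serreCharEval hK g.2 τ₀ ϖ.isIntegral_elt ϖ.norm_elt)

/-- **`Γ`-equivariance at level `p^k`: `(σg)(ϖ) = σ(g(ϖ))`**, i.e. `alphaUnit (σg) = weilAct σ (alphaUnit g)`. [cite: Milne1999, §5 p. 63 L8–L9] -/
theorem alphaUnit_infinityTypesRep (σ : cmNumbers ≃ₐ[ℚ] cmNumbers)
    (g : infinityTypes (cmNumbers ≃ₐ[ℚ] cmNumbers) (K →ₐ[ℚ] cmNumbers) cmNumbersConj) :
    alphaUnit hK ϖ (infinityTypesRep (cmNumbers ≃ₐ[ℚ] cmNumbers) (K →ₐ[ℚ] cmNumbers) cmNumbersConj σ g) =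
      weilAct p ϖ.level σ (alphaUnit hK ϖ g) := by
  refine Subtype.ext (Units.ext ?_)
  rw [coe_alphaUnit, coe_infinityTypesRep_apply, coe_weilAct, coe_alphaUnit, map_serreCharEval]

/-- `𝟙(ϖ) = Nm(ϖ) = p^k`: on the constant character `1 = X^*(s^K)(1)` the unit is `p^k ∈ W(p^k)` (g15-#3's `natCastPowUnit`).
[cite: Milne1999, §5 p. 63 Rem. 5.2 (c)] -/
theorem alphaUnit_constChar_one :
    alphaUnit hK ϖ (constChar (cmNumbers ≃ₐ[ℚ] cmNumbers) (K →ₐ[ℚ] cmNumbers) cmNumbersConj 1) = natCastPowUnit (ϖ.level : ℕ) := by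
  refine Subtype.ext (Units.ext ?_)
  rw [coe_alphaUnit, coe_constChar, coe_serreCharEval_const_one, coe_natCastPowUnit, PPowNormElt.coe_unit,
    prod_apply_eq_algebraMap_norm hK, ϖ.norm_elt, map_pow, map_natCast]

/-- **THE HOMOMORPHISM `g ↦ [g(ϖ)] : X^*(S^K) → W(p^∞) = X^*(P)`** («we have a homomorphism `g ↦ [g(ϖ)] : X^*(S^K) → W^K(p^∞)` … We
sometimes denote this map as `g ↦ π(g)`»), `ℤ`-linear into the additively written `X^*(P) = Additive W(p^∞)` of g15-#3.
[cite: Milne1999, §5 p. 63 L6–L8] -/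
def alphaChar : infinityTypes (cmNumbers ≃ₐ[ℚ] cmNumbers) (K →ₐ[ℚ] cmNumbers) cmNumbersConj →ₗ[ℤ] Additive (WeilLimit p) :=
  AddMonoidHom.toIntLinearMap
    { toFun := fun g => Additive.ofMul (weilGerm ϖ.level (alphaUnit hK ϖ g))
      map_zero' := by rw [alphaUnit_zero, weilGerm_one]; rfl
      map_add' := fun g g' => by rw [alphaUnit_add, ← weilGerm_mul]; rfl }

/-- `alphaChar ϖ g = [g(ϖ)]`. [cite: Milne1999, §5 p. 63 L6–L8] -/
theorem alphaChar_apply (g : infinityTypes (cmNumbers ≃ₐ[ℚ] cmNumbers) (K →ₐ[ℚ] cmNumbers) cmNumbersConj) :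
    alphaChar hK ϖ g = Additive.ofMul (weilGerm ϖ.level (alphaUnit hK ϖ g)) := rfl

/-- `[g(ϖ)]` read multiplicatively. [cite: Milne1999, §5 p. 63 L6–L8] -/
@[simp] theorem toMul_alphaChar_apply (g : infinityTypes (cmNumbers ≃ₐ[ℚ] cmNumbers) (K →ₐ[ℚ] cmNumbers) cmNumbersConj) :
    Additive.toMul (alphaChar hK ϖ g) = weilGerm ϖ.level (alphaUnit hK ϖ g) := rfl

/-- **«It commutes with the action of `Γ`»**: `X^*(α^K)` is `Γ`-EQUIVARIANT from skel-3's `infinityTypesRep` (= `characterRep` on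
`X^*(S^K)`) to g15-#3's `weilLimRep` on `X^*(P)`: `[(σg)(ϖ)] = σ[g(ϖ)]`. [cite: Milne1999, §5 p. 63 L8–L9] -/
theorem alphaChar_infinityTypesRep (σ : cmNumbers ≃ₐ[ℚ] cmNumbers)
    (g : infinityTypes (cmNumbers ≃ₐ[ℚ] cmNumbers) (K →ₐ[ℚ] cmNumbers) cmNumbersConj) :
    alphaChar hK ϖ (infinityTypesRep (cmNumbers ≃ₐ[ℚ] cmNumbers) (K →ₐ[ℚ] cmNumbers) cmNumbersConj σ g) =
      weilLimRep p σ (alphaChar hK ϖ g) := by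
  rw [alphaChar_apply, alphaChar_apply, alphaUnit_infinityTypesRep, weilLimRep_apply, toMul_ofMul, smul_weilGerm]

/-- **`[g(ϖ)]` has weight `wt(g)`**: `weilLimExp [g(ϖ)] = −wt(g) = g(τ₀) + g(ιτ₀)` (the map `X^*(S^K) → X^*(P)` is compatible with the
weights `w` of `S` and of `P`). [cite: Milne1999, §5 p. 63 L3–L5] -/
theorem weilLimExp_alphaChar (g : infinityTypes (cmNumbers ≃ₐ[ℚ] cmNumbers) (K →ₐ[ℚ] cmNumbers) cmNumbersConj)
    (τ₀ : K →ₐ[ℚ] cmNumbers) :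
    weilLimExp (Additive.toMul (alphaChar hK ϖ g)) = -weight cmNumbersConj τ₀ (g : (K →ₐ[ℚ] cmNumbers) → ℤ) := by
  rw [toMul_alphaChar_apply, weilLimExp_weilGerm, weilExp_alphaUnit]

/-- **Remark 5.2 (c) on characters: `X^*(α^K)(s^K) = [p]`** — the constant character `1` (the character `s^K = X^*(t)(1)` of `S^K`,
Q768's `constChar`) goes to `[𝟙(ϖ)] = [Nm ϖ] = [p^k]_k = [p] = pGerm` («`α^K` sends `p^K` to `s^K`»). [cite: Milne1999, §5 p. 63 Rem. 5.2 (c)] -/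
theorem alphaChar_constChar_one :
    alphaChar hK ϖ (constChar (cmNumbers ≃ₐ[ℚ] cmNumbers) (K →ₐ[ℚ] cmNumbers) cmNumbersConj 1) = Additive.ofMul pGerm := by
  rw [alphaChar_apply, alphaUnit_constChar_one, weilGerm_natCastPowUnit]

/-! ### §5 `α^K : (P, p) → (S^K, s^K)` on points -/

variable (R : Type*) [CommRing R] [Algebra ℚ R]

/-- **`α^K(R) : P(R) → S^K(R)`** for every commutative `ℚ`-algebra `R` («and so defines a homomorphism `α^K : P^K → S^K`»): Q768 FILE 1's
`torusPoints.comap` of the equivariant `X^*(α^K) = alphaChar`, from g15-#3's `weilTorusPoints p R = P(R)` to Q768 FILE 3's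
`serrePoints ℚ ℚ^{cm} K ι R = S^K(R)`. [cite: Milne1999, §5 p. 63 L8–L9] -/
def alphaPoints : weilTorusPoints p R →* serrePoints ℚ cmNumbers K cmNumbersConj R :=
  torusPoints.comap ℚ cmNumbers R
    (infinityTypesRep (cmNumbers ≃ₐ[ℚ] cmNumbers) (K →ₐ[ℚ] cmNumbers) cmNumbersConj) (weilLimRep p)
    (alphaChar hK ϖ) (alphaChar_infinityTypesRep hK ϖ)

variable {R} in
/-- Values: `α^K(f)(g) = f([g(ϖ)])`. [cite: Milne1999, §5 p. 63 L8–L9] -/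
theorem alphaPoints_apply_ofAdd (f : weilTorusPoints p R)
    (g : infinityTypes (cmNumbers ≃ₐ[ℚ] cmNumbers) (K →ₐ[ℚ] cmNumbers) cmNumbersConj) :
    (alphaPoints hK ϖ R f : Multiplicative (infinityTypes (cmNumbers ≃ₐ[ℚ] cmNumbers) (K →ₐ[ℚ] cmNumbers) cmNumbersConj) →*
        (cmNumbers ⊗[ℚ] R)ˣ) (Multiplicative.ofAdd g) =
      germChar (weilGerm ϖ.level (alphaUnit hK ϖ g)) f := rfl

variable {R} {R' : Type*} [CommRing R'] [Algebra ℚ R'] in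
/-- `α^K` is natural in `R` (a morphism of group functors on `ℚ`-algebras). [cite: Milne1999, §5 p. 63 L8–L9] -/
theorem map_alphaPoints (φ : R →ₐ[ℚ] R') (f : weilTorusPoints p R) :
    torusPoints.map ℚ cmNumbers R (infinityTypesRep (cmNumbers ≃ₐ[ℚ] cmNumbers) (K →ₐ[ℚ] cmNumbers) cmNumbersConj) R' φ
        (alphaPoints hK ϖ R f) =
      alphaPoints hK ϖ R' (torusPoints.map ℚ cmNumbers R (weilLimRep p) R' φ f) := rfl

variable {R} in
/-- **Remark 5.2 (c) on points: `s^K(α^K(f)) = p(f)`** — the character `s^K` of `S^K` (evaluation at the constant character `1`)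
pulls back to the character `p = [p]` of `P` (g15-#3's `germChar pGerm`): `α^K : (P, p) → (S^K, s^K)` is a morphism of pairs.
[cite: Milne1999, §5 p. 63 Rem. 5.2 (c)] -/
theorem eval_constChar_alphaPoints (f : weilTorusPoints p R) :
    torusPoints.eval ℚ cmNumbers R (infinityTypesRep (cmNumbers ≃ₐ[ℚ] cmNumbers) (K →ₐ[ℚ] cmNumbers) cmNumbersConj)
        (constChar (cmNumbers ≃ₐ[ℚ] cmNumbers) (K →ₐ[ℚ] cmNumbers) cmNumbersConj 1) (alphaPoints hK ϖ R f) =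
      germChar pGerm f :=
  -- term mode (as in g15-#1/#3): both sides are values of `f`
  (alphaPoints_apply_ofAdd hK ϖ f _).trans
    (congrArg (fun x : Additive (WeilLimit p) =>
        (f : Multiplicative (Additive (WeilLimit p)) →* (cmNumbers ⊗[ℚ] R)ˣ) (Multiplicative.ofAdd x))
      (alphaChar_constChar_one hK ϖ))

/-- The values `s^K(α^K(f)) = p(f)` are `Γ`-invariant units (both characters are rational over `ℚ`). [cite: Milne1999, §5 p. 63 Rem. 5.2 (c)] -/
theorem galUnits_eval_constChar_alphaPoints (σ : cmNumbers ≃ₐ[ℚ] cmNumbers) (f : weilTorusPoints p R) :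
    galUnits ℚ cmNumbers R σ
        (torusPoints.eval ℚ cmNumbers R (infinityTypesRep (cmNumbers ≃ₐ[ℚ] cmNumbers) (K →ₐ[ℚ] cmNumbers) cmNumbersConj)
          (constChar (cmNumbers ≃ₐ[ℚ] cmNumbers) (K →ₐ[ℚ] cmNumbers) cmNumbersConj 1) (alphaPoints hK ϖ R f)) =
      torusPoints.eval ℚ cmNumbers R (infinityTypesRep (cmNumbers ≃ₐ[ℚ] cmNumbers) (K →ₐ[ℚ] cmNumbers) cmNumbersConj)
        (constChar (cmNumbers ≃ₐ[ℚ] cmNumbers) (K →ₐ[ℚ] cmNumbers) cmNumbersConj 1) (alphaPoints hK ϖ R f) := by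
  rw [eval_constChar_alphaPoints]
  exact galUnits_germChar_pGerm p R σ f

end Alpha

/-! ### §6 «`g` maps units in `K` to roots of unity» (Milne CM Rem. 4.15, the tree's `unitCharEval_pow_eq_one`, transported to
the `ℚ^{cm}`-carrier) and the independence of `[g(ϖ)]` from the choice of the generator `ϖ` -/

section Units

open Literature.AlgebraicGeometry.Pohlmann1968 (isPretransitive_ringEquiv_complex)

variable (hK : IsTotallyReal K ∨ IsCMField K)

/-- The character `g : Hom_ℚ(K, ℚ^{cm}) → ℤ` read on the complex carrier `Hom(K, ℂ)` of skel-3's `charGroup K` (along §2's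
`embEquivComplex`). [cite: MilneCM2006, Ch. I §4 Rem. 4.15] -/
def toComplexChar (g : (K →ₐ[ℚ] cmNumbers) → ℤ) : (K →+* ℂ) → ℤ :=
  fun φ => g ((embEquivComplex K hK).symm φ.toRatAlgHom)

/-- `toComplexChar g (τ) = g(τ)`. [cite: MilneCM2006, Ch. I §4 Rem. 4.15] -/
theorem toComplexChar_apply_toRingHom (g : (K →ₐ[ℚ] cmNumbers) → ℤ) (τ : K →ₐ[ℚ] cmNumbers) :
    toComplexChar hK g (embEquivComplex K hK τ).toRingHom = g τ :=
  congrArg g ((embEquivComplex K hK).symm_apply_apply τ)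

/-- **`g(a)`, read in `ℂ`, is the tree's `charEval` of the transported character** (`SerreGroupCharacterValues`, Milne CM Rem. 4.15's
`f(a) = ∏_φ φ(a)^{f(φ)}`). [cite: MilneCM2006, Ch. I §4 Rem. 4.15] -/
theorem coe_coe_serreCharEval (g : (K →ₐ[ℚ] cmNumbers) → ℤ) (a : Kˣ) :
    (((serreCharEval g a : cmNumbersˣ) : cmNumbers) : ℂ) = ((charEval (toComplexChar hK g) a : ℂˣ) : ℂ) := by
  rw [coe_serreCharEval_apply, coe_charEval_apply]
  change (IntermediateField.val cmNumbers) (∏ τ : K →ₐ[ℚ] cmNumbers, τ (a : K) ^ g τ) = _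
  rw [map_prod]
  simp_rw [map_zpow₀]
  refine Fintype.prod_equiv ((embEquivComplex K hK).trans RingHom.equivRatAlgHom.symm) _ _ fun τ => ?_
  have h1 : toComplexChar hK g (((embEquivComplex K hK).trans RingHom.equivRatAlgHom.symm) τ) = g τ :=
    toComplexChar_apply_toRingHom hK g τ
  rw [h1]
  rfl

/-- Over `K` totally real or CM, complex conjugation commutes with `Aut(ℂ)` on `Hom(K, ℂ)` (all embeddings land in `ℚ^{cm}`).
[cite: MilneCM2006, Ch. I §1 Rem. 1.7 (p. 11)] -/
theorem ringEquiv_smul_conj_smul (hK : IsTotallyReal K ∨ IsCMField K) (σ : ℂ ≃+* ℂ) (φ : K →+* ℂ) :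
    σ • (starRingAut : ℂ ≃+* ℂ) • φ = (starRingAut : ℂ ≃+* ℂ) • σ • φ := by
  ext x
  change σ (starRingAut (φ x)) = starRingAut (σ (φ x))
  rw [starRingAut_apply, starRingAut_apply]
  exact Literature.NumberTheory.NumberFields.conj_comm_of_mem_cmNumbers
    ((fieldRange_le_cmNumbers_iff K φ).mpr hK ⟨x, rfl⟩) σ

/-- Transport of complex conjugation: `(ι ∘ φ)` on `Hom(K, ℂ)` corresponds to `cmNumbersConj • τ` on `Hom_ℚ(K, ℚ^{cm})`.
[cite: MilneCM2006, Ch. I §1 Rem. 1.7 (p. 11)] -/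
theorem embEquivComplex_symm_conj_smul (φ : K →+* ℂ) :
    (embEquivComplex K hK).symm (((starRingAut : ℂ ≃+* ℂ) • φ).toRatAlgHom) =
      cmNumbersConj • (embEquivComplex K hK).symm φ.toRatAlgHom := by
  ext x
  change starRingAut (φ x) = ((cmNumbersConj ((embEquivComplex K hK).symm φ.toRatAlgHom x) : cmNumbers) : ℂ)
  rw [starRingAut_apply, Literature.NumberTheory.NumberFields.coe_cmNumbersConj]
  rfl

/-- **The transported character lies in skel-3's `charGroup K = X^*(S^K)` on `Hom(K, ℂ)`** when `g ∈ X^*(S^K)` on `Hom_ℚ(K, ℚ^{cm})`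
(Milne CM Prop. 4.9 (a): `f(φ) + f(ιφ)` constant; transitivity of `Aut(ℂ)` on `Hom(K, ℂ)` is the tree's
`Pohlmann1968.isPretransitive_ringEquiv_complex`). [cite: MilneCM2006, Ch. I §4 Prop. 4.9] -/
theorem toComplexChar_mem {g : (K →ₐ[ℚ] cmNumbers) → ℤ}
    (hg : g ∈ infinityTypes (cmNumbers ≃ₐ[ℚ] cmNumbers) (K →ₐ[ℚ] cmNumbers) cmNumbersConj) :
    toComplexChar hK g ∈ charGroup K := by
  haveI := isPretransitive_ringEquiv_complex (K := K)
  obtain ⟨τ₀⟩ := nonempty_algHom_cmNumbers hK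
  rw [mem_infinityTypes_iff_exists_of_comm (ringEquiv_smul_conj_smul hK)]
  refine ⟨-weight cmNumbersConj τ₀ g, fun φ => ?_⟩
  change g _ + g _ = _
  rw [embEquivComplex_symm_conj_smul hK]
  exact apply_add_apply_smul_eq_neg_weight cmNumbersConj_mul_self hg τ₀ _

variable [IsCMField K]

omit hK in
/-- **«`g` maps units in `K` to roots of unity»** (for `K` CM): `g(u)^N = 1` for every unit `u ∈ 𝓞_K^×` and every `g ∈ X^*(S^K)`,
with the tree's uniform exponent `N = [𝓞_K^× : 𝓞_{K⁺}^× μ(K)]·2|μ(K)|` (Milne CM Rem. 4.15 = the tree's `unitCharEval_pow_eq_one`,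
read in `ℚ^{cm}`). [cite: Milne1999, §5 p. 62 L36 – p. 63 L2] [cite: MilneCM2006, Ch. I §4 Rem. 4.15] -/
theorem serreCharEval_unit_pow_eq_one {g : (K →ₐ[ℚ] cmNumbers) → ℤ}
    (hg : g ∈ infinityTypes (cmNumbers ≃ₐ[ℚ] cmNumbers) (K →ₐ[ℚ] cmNumbers) cmNumbersConj) (u : (𝓞 K)ˣ) :
    serreCharEval g (Units.map (algebraMap (𝓞 K) K).toMonoidHom u) ^
        (IsCMField.indexRealUnits K * (2 * Units.torsionOrder K)) = 1 := by
  have hK : IsTotallyReal K ∨ IsCMField K := Or.inr ‹_›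
  have h := unitCharEval_pow_eq_one (toComplexChar_mem hK hg) u
  rw [unitCharEval_apply] at h
  have h' := congrArg (fun x : ℂˣ => (x : ℂ)) h
  simp only [Units.val_pow_eq_pow_val, Units.val_one] at h'
  refine Units.ext (Subtype.ext ?_)
  rw [Units.val_pow_eq_pow_val, Units.val_one, SubmonoidClass.coe_pow, OneMemClass.coe_one, coe_coe_serreCharEval hK]
  exact h'

omit hK in
/-- The uniform exponent is non-zero. [cite: MilneCM2006, Ch. I §4 Rem. 4.15] -/
private theorem unitExponent_ne_zero : IsCMField.indexRealUnits K * (2 * Units.torsionOrder K) ≠ 0 := by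
  have h1 : IsCMField.indexRealUnits K ≠ 0 := by
    rcases IsCMField.indexRealUnits_eq_one_or_two K with h | h <;> simp [h]
  exact mul_ne_zero h1 (mul_ne_zero two_ne_zero (Units.torsionOrder_ne_zero K))

variable {p : ℕ} [hp : Fact p.Prime]

/-- **«The class it represents in `W(p^∞)` is independent of the choice of `ϖ`»**: two data `ϖ, ϖ′` differing by a unit
`u ∈ 𝓞_K^×` (two generators of the same ideal `𝔭_{w₀}^h`) give the SAME homomorphism `g ↦ [g(ϖ)] = [g(ϖ′)]` — `g(ϖ′) = g(ϖ)·g(u)`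
with `g(u)` a root of unity, and germs ignore roots of unity (g15-#3's `weilGerm_eq_weilGerm_iff`). [cite: Milne1999, §5 p. 63 L3–L7] -/
theorem alphaChar_eq_of_elt_eq_mul_unit (ϖ ϖ' : PPowNormElt K p) (u : (𝓞 K)ˣ)
    (h : ϖ'.elt = ϖ.elt * algebraMap (𝓞 K) K (u : 𝓞 K)) : alphaChar hK ϖ' = alphaChar hK ϖ := by
  -- the levels agree: `p^{k′} = Nm ϖ′ = Nm ϖ · Nm u = ± p^k`
  have hu1 : |Algebra.norm ℚ (algebraMap (𝓞 K) K (u : 𝓞 K))| = 1 := by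
    rw [← RingOfIntegers.coe_eq_algebraMap, ← RingOfIntegers.coe_norm]
    exact NumberField.isUnit_iff_norm.mp u.isUnit
  have hlev : (ϖ'.level : ℕ) = ϖ.level := by
    have h1 := ϖ'.norm_elt
    rw [h, map_mul, ϖ.norm_elt] at h1
    have h2 := congrArg abs h1
    rw [abs_mul, hu1, mul_one, abs_pow, abs_pow, Nat.abs_cast] at h2
    have h3 : (p : ℕ) ^ (ϖ.level : ℕ) = p ^ (ϖ'.level : ℕ) := by exact_mod_cast h2
    exact (Nat.pow_right_injective hp.out.two_le h3).symm
  have hunit : ϖ'.unit = ϖ.unit * Units.map (algebraMap (𝓞 K) K).toMonoidHom u :=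
    Units.ext (by rw [Units.val_mul, PPowNormElt.coe_unit, PPowNormElt.coe_unit, Units.coe_map, RingHom.toMonoidHom_eq_coe,
      MonoidHom.coe_coe, h])
  refine LinearMap.ext fun g => ?_
  rw [alphaChar_apply, alphaChar_apply]
  refine congrArg Additive.ofMul ((weilGerm_eq_weilGerm_iff _ _).mpr ?_)
  refine ⟨IsCMField.indexRealUnits K * (2 * Units.torsionOrder K), unitExponent_ne_zero, ?_⟩
  rw [coe_alphaUnit, coe_alphaUnit, hunit, map_mul, hlev, mul_pow, mul_comm, mul_div_assoc, div_self', mul_one, ← pow_mul,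
    mul_comm (ϖ.level : ℕ), pow_mul, serreCharEval_unit_pow_eq_one g.2 u, one_pow]

end Units

end CMNumbers

end Literature.NumberTheory.ComplexMultiplication

end
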